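import Summits.BirchSwinnertonDyer.BirchSwinnertonDyer.Theorems.ClassRecordThreeEulerHalvesAtThreeWalkTildeSign
import Summits.BirchSwinnertonDyer.BirchSwinnertonDyer.Theorems.ClassRecordThreeCornerAtThreeShimuraSwapFamilyTilde
import HarnessLib

/-!
# (P2) walk bookkeeping over the GENERALISED datum: the SIGN of the root class and the engine's `hκt` ∕ `h49` from PURE
# Selmer membership, for a family `D s : JET.KolyvaginFamilyData W K ι s` — family twins of this seat's `…WalkTildeSign`
# (cell `bsd-stepL`, seat `bsd-stepL-tam3-p1` g13, owner of 19109's line; `--supports stmt-BirchSwinnertonDyer-19109 --as helper`)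

HONEST FRAMING. Nothing here proves BSD, J₃ or any divisibility of a CM ∕ Heegner point; no stub is discharged; no item closes;
0 classes move (T7). THEOREMS ONLY (no definition, no named fact, no `sorry`).

WHY (RULING 46 «tam3-p1: the walk»; corner3-p2 g8's END GLUE `ShimuraWalk.levelSupplyAt_of_familyLevelSupply`, p598543: the port
target `LevelSupplyAtThreeB6` ⟸ `hlevF` = the per-level inequality for the data `d : KolyvaginFamilyData` OF THE FAMILY (`d.y = ys n`),
which is the conclusion of the family-agnostic per-level ENGINE — this seat's `Koly.tamagawaExponent_le_m_of_orderedFamiliesBase_family`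
(p595546, Zhang index) or corner3-p2's `…_of_classes` (p593074, any depth function) — once its class-level supplies are proved for the
labelled family). Two of those supplies are BOOKKEEPING over the memberships: `hκt` (a root class `x` of order `p^k` in the
`ε(s)`-part of `H_{𝓕(s)}` with `κ(s) = p^{m(s)}·x`) and `h49` (`κ(sℓ)` in the `−ε(s)`-part of `H_{𝓕₀(s)^λ}`). On `X₀(N)` this seat
derived them (`Koly.hκt_of_selmerMembership`, `Koly.h49_of_selmerMembership`, `…WalkTildeSign`) from the PURE memberships, Gross
Prop. 5.3 at the divisors and the `X₀(N)`-specific standing inputs (`ρ̄` onto ⇒ admissibility; data at the divisors ⇒ invariance;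
bsd-jet's concrete Prop. 5.4 (1)). THIS FILE is the family twin with every `X₀(N)`-specific input turned into a HYPOTHESIS in the
shape lane B's carrier delivers for the labelled CM family (`hpointsRk_of_labelsAt_of_noTorsion_walkDepth`, p-today: admissibility of
`A_s` at EVERY depth, invariance of `[P_s]` at every depth `≤ M(s)`, the `τ̃`-stability of `A_s`, and the SIGN CONGRUENCE
`τ̃ P_s = ε(−1)^{r(s)} P_s + p^j B` = Gross Prop. 5.4 (1) from the eigen label (B3) and the weak trace label (B4)):
* `conjAct_kolyvaginClass_root_eq_smul_family` — Gross Prop. 5.4 (2) on the ROOT class `c_k(Q)`, `p^u Q = P_s`, from the congruence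
  at level `p^{k+u}` (proof = the `X₀(N)` one verbatim; the datum enters through `pointsSubgroup ∕ toGeomPoints ∕ derivedPoint` only);
* `hκt_of_selmerMembership_family` — the engine's `hκt` for `κ s := (D s).kolyvaginClass`, `md s := (D s).divOrd p` and ANY level-index
  function `Midx` (Zhang's `levelIndex` or Gross's `frobLevelIndex`) over ANY admissibility predicate `Adm`, from: admissibility (`hA`),
  invariance (`hP`), `τ̃`-stability (`hAτ`), the sign congruence (`hsign`), the sign convention (`hebε`), `ord_p(P_s) < ∞` when
  `M(s) = ∞` (`hdivfin`), and the PURE membership `hselmer` of the root classes — with corner-p1 g15's `exists_rootClass_of_exactDepth`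
  (p-today) for the tilde class;
* `h49_of_selmerMembership_family` — the engine's `h49` from the PURE membership `hsel0` of `κ(sℓ)` in `H_{𝓕₀(s)^λ}` and the sign
  congruence at level `p^k` (`u = 0`).
The index subtype, `Midx`, `eb`, `ε`, `τ̃` are parameters, so the three theorems serve both engines and both corner lines (21420 ∕ 19109).
References (locators only; no cited FACT declared): [cite: Jetchev2008, §3.1 items 6–7 (p. 817), Prop. 4.5–4.6, 4.9 (pp. 819–821),
proof of Thm. 5.2 (p. 822)] [cite: GrossLMS1991, §5 Prop. 5.3, Prop. 5.4 (1)–(2)] [cite: McCallumLMS1991, §4 (4)–(6), Cor. 4.5].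
presearch: not applicable (re-keying of this seat's tree theorems); `lean search 'hκt_of_selmerMembership_family|root_eq_smul_family'` → none.
Design: theorems only; `K : Type`. Axioms: `propext`, `Classical.choice`, `Quot.sound`.
-/

set_option autoImplicit false

noncomputable section

open scoped Classical NumberField

namespace Summit.BirchSwinnertonDyer.Rank1Residual.X11b.Three.Koly

open WeierstrassCurve IsDedekindDomain NumberField Field Literature.NumberTheory.EllipticCurves
  Literature.NumberTheory.EllipticCurves.ModularForms Literature.NumberTheory.EllipticCurves.KolyvaginCocycle
  Literature.NumberTheory.EllipticCurves.Jetchev2008 Literature.NumberTheory.GaloisRepresentations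
  Summit.BirchSwinnertonDyer.Rank1Residual.X11b Summit.BirchSwinnertonDyer.Rank1Residual.JET

variable {K : Type} [Field K] [NumberField K] {W : WeierstrassCurve ℚ} {ι : K →+* ℂ} {n : ℕ}

/-! ### §1 The sign of the root class (Gross Prop. 5.4 (2) from Prop. 5.4 (1) at the deeper level) -/

/-- **The sign of `κ̃` from Gross Prop. 5.4 (1) at the deeper level, family datum.** If `τ̃ P_n = ε P_n + p^{k+u} B` with
`B ∈ A = E(K[n])` (`τ̃` a lift of `c ∈ Aut(K/ℚ)`, `A` `τ̃`-stable and admissible for `p^{k+u}`), then for every `Q ∈ E(K[n])` with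
`p^u Q = P_n` and `[Q]` invariant mod `p^k`: `c_* c(Q) = ε • c(Q)` in `H¹(K, E[p^k])`. Twin (proof verbatim) of
`conjAct_kolyvaginClass_root_eq_smul`. [cite: GrossLMS1991, Prop. 5.4 (1)–(2)] [cite: Jetchev2008, §3.1 item 6 (p. 817)] -/
theorem conjAct_kolyvaginClass_root_eq_smul_family [W.IsElliptic] (d : KolyvaginFamilyData W K ι n) {p : ℕ}
    (hp : p.Prime) {k u : ℕ}
    (hA : IsAdmissible (absoluteGaloisGroup K) d.pointsSubgroup ((p ^ (k + u) : ℕ) : ℤ))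
    {c : K ≃ₐ[ℚ] K} {τ : AlgebraicClosure K ≃+* AlgebraicClosure K} (hτ : IsLiftOfAut c τ)
    (hAτ : ∀ a ∈ d.pointsSubgroup, hτ.pointsMap W a ∈ d.pointsSubgroup) (ε : ℤ)
    (hcong : ∃ B ∈ d.pointsSubgroup, hτ.pointsMap W (d.toGeomPoints d.derivedPoint) =
      ε • d.toGeomPoints d.derivedPoint + ((p ^ (k + u) : ℕ) : ℤ) • B)
    (Q : (W.baseChange (ringClassField K ι n)).toAffine.Point)
    (hQP : ((p ^ u : ℕ) : ℤ) • Q = d.derivedPoint)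
    (hAk : IsAdmissible (absoluteGaloisGroup K) d.pointsSubgroup ((p ^ k : ℕ) : ℤ))
    (hQ : d.toGeomPoints Q ∈ invPoints (absoluteGaloisGroup K) d.pointsSubgroup ((p ^ k : ℕ) : ℤ)) :
    conjAct W c ((p ^ k : ℕ) : ℤ) (kolyvaginClass (W.baseChange K) ((p ^ k : ℕ) : ℤ)
        ((W.baseChange K).zsmul_geomPoints_surjective_of_charZero
          (by exact_mod_cast pow_ne_zero k hp.ne_zero)) hAk (d.toGeomPoints Q) hQ) =
      ε • kolyvaginClass (W.baseChange K) ((p ^ k : ℕ) : ℤ)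
        ((W.baseChange K).zsmul_geomPoints_surjective_of_charZero
          (by exact_mod_cast pow_ne_zero k hp.ne_zero)) hAk (d.toGeomPoints Q) hQ := by
  obtain ⟨B, hB, hcong⟩ := hcong
  have hQA : d.toGeomPoints Q ∈ d.pointsSubgroup := ⟨Q, rfl⟩
  have hPeq : d.toGeomPoints d.derivedPoint = ((p ^ u : ℕ) : ℤ) • d.toGeomPoints Q := by
    rw [← map_zsmul, hQP]
  -- divide the congruence by `p^u`
  have h1 : ((p ^ u : ℕ) : ℤ) •
      (hτ.pointsMap W (d.toGeomPoints Q) - (ε • d.toGeomPoints Q + ((p ^ k : ℕ) : ℤ) • B)) = 0 := by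
    rw [smul_sub, ← hτ.pointsMap_zsmul, ← hPeq, hcong, hPeq, smul_add, smul_comm ε,
      smul_smul (((p ^ u : ℕ) : ℤ)) (((p ^ k : ℕ) : ℤ)), ← natCast_pow_add_eq_mul, Nat.add_comm u k,
      sub_self]
  have hmem : hτ.pointsMap W (d.toGeomPoints Q) - (ε • d.toGeomPoints Q + ((p ^ k : ℕ) : ℤ) • B) ∈
      d.pointsSubgroup :=
    d.pointsSubgroup.sub_mem (hAτ _ hQA)
      (d.pointsSubgroup.add_mem (d.pointsSubgroup.zsmul_mem hQA _) (d.pointsSubgroup.zsmul_mem hB _))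
  have hcongQ : hτ.pointsMap W (d.toGeomPoints Q) = ε • d.toGeomPoints Q + ((p ^ k : ℕ) : ℤ) • B := by
    refine sub_eq_zero.mp (hA.eq_zero_of_zsmul hmem ?_)
    rw [natCast_pow_add_eq_mul, mul_smul, h1, smul_zero]
  exact conjAct_kolyvaginClass_eq_smul W hτ hAk hAτ hQ ε ⟨B, hB, hcongQ⟩

/-! ### §2 The engine's `hκt` from pure membership, family data, any index subtype and level-index function -/

/-- **The walk engine's `hκt` from PURE Selmer membership of the root classes — family data.** For a family `D` of generalised
Kolyvagin data on an index subtype `{m // Adm m}`, a level `k ≥ 1`, a level-index function `Midx` (Zhang's or Gross's), signs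
`eb`/`ε` with `hebε`, a lift `τ̃` of `τ` stabilising every `A_s = (D s).pointsSubgroup` (`hAτ`), and the STANDING INPUTS as
hypotheses — admissibility of `A_s` at every depth (`hA`), invariance of `[P_s]` mod `p^j` for `1 ≤ j ≤ M(s)` (`hP`), the sign
congruence `τ̃ P_s = ε(−1)^{#primes(s)} P_s + p^j B_s` for `1 ≤ j ≤ M(s)` (`hsign`, Gross Prop. 5.4 (1)) — plus `hdivfin`
(`ord_p(P_s) < ∞` when `M(s) = ∞`) and the PURE membership `hselmer` of the classes of the `p^u`-th roots `Q` of `P_s`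
(`p^{u+1} ∤ P_s`, `u + k ≤ M(s)`): the hypothesis `hκt` of the per-level engine for `κ s := c_k(s)`, `md s := ord_p(P_s)`.
[cite: Jetchev2008, §3.1 item 7, Prop. 4.5–4.6 (pp. 817–820), proof of Thm. 5.2 (p. 822)] [cite: GrossLMS1991, Prop. 5.4]
[cite: McCallumLMS1991, §4 (6), Cor. 4.5] -/
theorem hκt_of_selmerMembership_family (W : WeierstrassCurve ℚ) [W.IsElliptic] [W.IsGloballyMinimal]
    {p : ℕ} [Fact p.Prime] (ι : K →+* ℂ) {τ : K ≃ₐ[ℚ] K}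
    {τ' : AlgebraicClosure K ≃+* AlgebraicClosure K} (hτ' : IsLiftOfAut τ τ') {k : ℕ} (hk : 1 ≤ k)
    (𝒯 : Literature.NumberTheory.GaloisRepresentations.DiscreteGaloisModule.SelmerStructure
      ((W.baseChange K).torsionGaloisModule ((p ^ k : ℕ) : ℤ)))
    {Adm : ℕ → Prop} (D : ∀ s : {m : ℕ // Adm m}, KolyvaginFamilyData W K ι s.1) (Midx : ℕ → ℕ∞)
    (eb : ℕ → Bool) (ε : ℤ)
    (hebε : ∀ m, (if eb m then (1 : ℤ) else -1) = ε * (-1) ^ m.primeFactors.card)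
    (hA : ∀ (s : {m : ℕ // Adm m}) (j : ℕ),
      IsAdmissible (absoluteGaloisGroup K) (D s).pointsSubgroup ((p ^ j : ℕ) : ℤ))
    (hP : ∀ (s : {m : ℕ // Adm m}) (j : ℕ), 1 ≤ j → (j : ℕ∞) ≤ Midx s.1 →
      (D s).toGeomPoints (D s).derivedPoint ∈
        invPoints (absoluteGaloisGroup K) (D s).pointsSubgroup ((p ^ j : ℕ) : ℤ))
    (hAτ : ∀ (s : {m : ℕ // Adm m}), ∀ a ∈ (D s).pointsSubgroup, hτ'.pointsMap W a ∈ (D s).pointsSubgroup)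
    (hsign : ∀ (s : {m : ℕ // Adm m}) (j : ℕ), 1 ≤ j → (j : ℕ∞) ≤ Midx s.1 →
      ∃ B ∈ (D s).pointsSubgroup, hτ'.pointsMap W ((D s).toGeomPoints (D s).derivedPoint) =
        (ε * (-1) ^ s.1.primeFactors.card) • (D s).toGeomPoints (D s).derivedPoint + ((p ^ j : ℕ) : ℤ) • B)
    (hdivfin : ∀ s : {m : ℕ // Adm m}, Midx s.1 = ⊤ → (D s).divOrd p ≠ ⊤)
    (hselmer : ∀ (s : {m : ℕ // Adm m}) (u : ℕ) (Q : (W.baseChange (ringClassField K ι s.1)).toAffine.Point)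
      (hAk : IsAdmissible (absoluteGaloisGroup K) (D s).pointsSubgroup ((p ^ k : ℕ) : ℤ))
      (hQ : (D s).toGeomPoints Q ∈ invPoints (absoluteGaloisGroup K) (D s).pointsSubgroup ((p ^ k : ℕ) : ℤ)),
      ((p ^ u : ℕ) : ℤ) • Q = (D s).derivedPoint →
      (¬ ∃ Q' : (W.baseChange (ringClassField K ι s.1)).toAffine.Point,
        ((p ^ (u + 1) : ℕ) : ℤ) • Q' = (D s).derivedPoint) →
      ((u + k : ℕ) : ℕ∞) ≤ Midx s.1 →
      (kolyvaginClass (W.baseChange K) ((p ^ k : ℕ) : ℤ)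
        ((W.baseChange K).zsmul_geomPoints_surjective_of_charZero
          (by exact_mod_cast pow_ne_zero k (Fact.out : p.Prime).ne_zero)) hAk ((D s).toGeomPoints Q) hQ :
          galoisCohomology ((W.baseChange K).torsionGaloisModule ((p ^ k : ℕ) : ℤ)) 1) ∈
        (selmerF W ((p ^ k : ℕ) : ℤ) 𝒯 (placesDividing K s.1)).selmerGroup) :
    ∀ s : {m : ℕ // Adm m}, (if (D s).divOrd p < Midx s.1 then (D s).divOrd p else (⊤ : ℕ∞)) +
        (k : ℕ∞) ≤ Midx s.1 →
      ∃ x : galoisCohomology ((W.baseChange K).torsionGaloisModule ((p ^ k : ℕ) : ℤ)) 1,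
        x ∈ signPart W K τ ((p ^ k : ℕ) : ℤ) (if eb s.1 then 1 else -1)
          (selmerF W ((p ^ k : ℕ) : ℤ) 𝒯 (placesDividing K s.1)).selmerGroup ∧
        addOrderOf x = p ^ k ∧
        ((D s).kolyvaginClass (Fact.out : p.Prime) k :
            galoisCohomology ((W.baseChange K).torsionGaloisModule ((p ^ k : ℕ) : ℤ)) 1) =
          p ^ (if (D s).divOrd p < Midx s.1 then (D s).divOrd p else (⊤ : ℕ∞)).toNat • x := by
  have hp : p.Prime := Fact.out
  intro s hs
  by_cases hlt : (D s).divOrd p < Midx s.1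
  · rw [if_pos hlt] at hs ⊢
    -- `ord_p(P_s) = u` is finite; exact depth `p^u ∥ P_s`
    have hne : (D s).divOrd p ≠ ⊤ := ne_top_of_lt hlt
    obtain ⟨u, hu⟩ : ∃ u : ℕ, (D s).divOrd p = u := ⟨_, (ENat.coe_toNat hne).symm⟩
    rw [hu] at hs hlt ⊢
    simp only [ENat.toNat_coe]
    have hdvd : (D s).PDiv p u := (D s).pDiv_of_le_divOrd p u (le_of_eq hu.symm)
    have hndvd : ¬ (D s).PDiv p (u + 1) := fun h ↦ by
      have h' := (D s).natCast_le_divOrd_of_pDiv p h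
      rw [hu] at h'
      exact absurd (by exact_mod_cast h' : u + 1 ≤ u) (by omega)
    have huk : ((u + k : ℕ) : ℕ∞) ≤ Midx s.1 := by push_cast; exact hs
    have hku : ((k + u : ℕ) : ℕ∞) ≤ Midx s.1 := by rw [Nat.add_comm]; exact huk
    have h1ku : 1 ≤ k + u := hk.trans (Nat.le_add_right k u)
    -- the root class
    obtain ⟨hAk, Q, hQ, hQP, hord, hκ⟩ := (D s).exists_rootClass_of_exactDepth hp hk (hA s (k + u))
      (hP s (k + u) h1ku hku) hdvd hndvd
    -- its sign, from Gross Prop. 5.4 (1) at level `p^{k+u}`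
    have key := conjAct_kolyvaginClass_root_eq_smul_family (D s) hp (hA s (k + u)) hτ' (hAτ s) _
      (hsign s (k + u) h1ku hku) Q hQP hAk hQ
    refine ⟨_, (mem_signPart_iff W K τ _ _ _ _).mpr ⟨hselmer s u Q hAk hQ hQP hndvd huk, ?_⟩, hord, ?_⟩
    · rw [hebε]; exact key
    · rw [← natCast_zsmul]
      exact hκ
  · -- `m(s) = ⊤`: then `M(s) = ⊤` and `ord_p(P_s)` is finite — contradiction
    rw [if_neg hlt, top_add, top_le_iff] at hs
    exact (hlt (lt_of_lt_of_eq (lt_top_iff_ne_top.mpr (hdivfin s hs)) hs.symm)).elim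

/-! ### §3 The engine's `h49` from pure membership, family data -/

/-- **The walk engine's `h49` from PURE Selmer membership — family data** (the sign half of [J] Prop. 4.9 discharged). For a
family `D` on an index subtype all of whose levels have `M(s) ≥ k` (`hMidx`), admissibility at level `p^k` (`hA`), invariance of
`[P_s]` mod `p^k` (`hP`), `τ̃`-stability (`hAτ`), the sign congruence at level `p^k` (`hsign`) and the sign convention `hebε`: the
hypothesis `h49` of the per-level engine — `c_k(sℓ) ∈ (H_{𝓕₀(s)^λ})^{−ε(s)}` — follows from the PURE membership `hsel0 :
c_k(sℓ) ∈ H_{𝓕₀(s)^λ}`; the sign is Gross Prop. 5.4 (1) for `P_{sℓ}` itself (`u = 0`): `τ_* c_k(sℓ) = ε(−1)^{#primes(sℓ)} c_k(sℓ)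
= −ε(s) c_k(sℓ)`. The premises of `h49` are passed through. [cite: Jetchev2008, §3.1 item 6, Prop. 4.9 (pp. 817–821)]
[cite: GrossLMS1991, Prop. 5.3, Prop. 5.4] -/
theorem h49_of_selmerMembership_family (W : WeierstrassCurve ℚ) [W.IsElliptic] [W.IsGloballyMinimal]
    {p : ℕ} [Fact p.Prime] (ι : K →+* ℂ) {τ : K ≃ₐ[ℚ] K}
    {τ' : AlgebraicClosure K ≃+* AlgebraicClosure K} (hτ' : IsLiftOfAut τ τ') {k : ℕ} (hk : 1 ≤ k)
    (𝒯 𝒮 : Literature.NumberTheory.GaloisRepresentations.DiscreteGaloisModule.SelmerStructure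
      ((W.baseChange K).torsionGaloisModule ((p ^ k : ℕ) : ℤ)))
    (Qcar : Finset (HeightOneSpectrum (𝓞 K)))
    {Adm : ℕ → Prop} (D : ∀ s : {m : ℕ // Adm m}, KolyvaginFamilyData W K ι s.1) (Midx : ℕ → ℕ∞)
    (hMidx : ∀ s : {m : ℕ // Adm m}, (k : ℕ∞) ≤ Midx s.1)
    (eb : ℕ → Bool) (ε : ℤ)
    (hebε : ∀ m, (if eb m then (1 : ℤ) else -1) = ε * (-1) ^ m.primeFactors.card)
    (hA : ∀ (s : {m : ℕ // Adm m}) (j : ℕ),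
      IsAdmissible (absoluteGaloisGroup K) (D s).pointsSubgroup ((p ^ j : ℕ) : ℤ))
    (hP : ∀ (s : {m : ℕ // Adm m}) (j : ℕ), 1 ≤ j → (j : ℕ∞) ≤ Midx s.1 →
      (D s).toGeomPoints (D s).derivedPoint ∈
        invPoints (absoluteGaloisGroup K) (D s).pointsSubgroup ((p ^ j : ℕ) : ℤ))
    (hAτ : ∀ (s : {m : ℕ // Adm m}), ∀ a ∈ (D s).pointsSubgroup, hτ'.pointsMap W a ∈ (D s).pointsSubgroup)
    (hsign : ∀ (s : {m : ℕ // Adm m}) (j : ℕ), 1 ≤ j → (j : ℕ∞) ≤ Midx s.1 →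
      ∃ B ∈ (D s).pointsSubgroup, hτ'.pointsMap W ((D s).toGeomPoints (D s).derivedPoint) =
        (ε * (-1) ^ s.1.primeFactors.card) • (D s).toGeomPoints (D s).derivedPoint + ((p ^ j : ℕ) : ℤ) • B)
    (c : ℕ)
    (hsel0 : ∀ (s s' : {m : ℕ // Adm m}) (ℓ : ℕ), ℓ.Prime → ¬ ℓ ∣ s.1 → s'.1 = s.1 * ℓ →
      (∀ q ∈ s.1.primeFactors, q < ℓ) → c ∣ s.1 →
      ∀ v : HeightOneSpectrum (𝓞 K), (ℓ : 𝓞 K) ∈ v.asIdeal →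
      ((D s').kolyvaginClass (Fact.out : p.Prime) k :
          galoisCohomology ((W.baseChange K).torsionGaloisModule ((p ^ k : ℕ) : ℤ)) 1) ∈
        (((selmerF0 W ((p ^ k : ℕ) : ℤ) 𝒯 𝒮 (placesDividing K s.1) Qcar).relaxedAt {v}).selmerGroup)) :
    ∀ (s s' : {m : ℕ // Adm m}) (ℓ : ℕ), ℓ.Prime → ¬ ℓ ∣ s.1 → s'.1 = s.1 * ℓ →
      (∀ q ∈ s.1.primeFactors, q < ℓ) → c ∣ s.1 →
      ∀ v : HeightOneSpectrum (𝓞 K), (ℓ : 𝓞 K) ∈ v.asIdeal →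
      ((D s').kolyvaginClass (Fact.out : p.Prime) k :
          galoisCohomology ((W.baseChange K).torsionGaloisModule ((p ^ k : ℕ) : ℤ)) 1) ∈
        signPart W K τ ((p ^ k : ℕ) : ℤ) (if !eb s.1 then 1 else -1)
          (((selmerF0 W ((p ^ k : ℕ) : ℤ) 𝒯 𝒮 (placesDividing K s.1) Qcar).relaxedAt {v}).selmerGroup) := by
  have hp : p.Prime := Fact.out
  intro s s' ℓ hℓ hℓs hs' hlt hcs v hv
  have hmem := hsel0 s s' ℓ hℓ hℓs hs' hlt hcs v hv
  -- the two standing inputs at level `p^k` for the datum at `s'`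
  have hAk := hA s' k
  have hPk := hP s' k hk (hMidx s')
  -- Gross Prop. 5.4 (1) for `P_{s'}` itself (`u = 0`)
  have key := conjAct_kolyvaginClass_root_eq_smul_family (D s') hp (u := 0)
    (by rw [Nat.add_zero]; exact hAk) hτ' (hAτ s') _ (by rw [Nat.add_zero]; exact hsign s' k hk (hMidx s'))
    (D s').derivedPoint (by simp) hAk hPk
  -- the sign `−ε(s) = ε(s')`
  have hs0 : s.1 ≠ 0 := fun h ↦ by
    rw [h, Nat.primeFactors_zero] at hlt
    rw [h] at hℓs
    exact hℓs (dvd_zero ℓ)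
  have hcard : s'.1.primeFactors.card = s.1.primeFactors.card + 1 := by
    rw [hs', Nat.primeFactors_mul hs0 hℓ.ne_zero, hℓ.primeFactors, Finset.union_comm,
      ← Finset.insert_eq, Finset.card_insert_of_notMem]
    exact fun h ↦ hℓs (Nat.dvd_of_mem_primeFactors h)
  have hsgn : (if !eb s.1 then (1 : ℤ) else -1) = ε * (-1) ^ s'.1.primeFactors.card := by
    rw [hcard, pow_succ, ← mul_assoc, ← hebε s.1]
    cases eb s.1 <;> simp
  rw [(D s').kolyvaginClass_eq_cocycleClass hp k hAk hPk] at hmem ⊢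
  exact (mem_signPart_iff W K τ _ _ _ _).mpr ⟨hmem, by rw [hsgn]; exact key⟩

end Summit.BirchSwinnertonDyer.Rank1Residual.X11b.Three.Koly

end
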